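import Summits.Schanuel.Schanuel.Theorems.RootDecomp1KLogLogCell04

/-!
# RootDecomp1KLogLogCell — lens 1, generation 35 «LOG-LOG CELL of 33364» (RootDecomp1KLogLogCell.lean 05ce2a21…, 1940 l) — continuation (RootDecomp1KLogLogCell05): §6 first half — the member coordinate `ρ_E = Σ_J 2^{-(2J)!}` (`efact_*`, `rhoE`, tails, `logLogLiouville_rhoE`)

(lens-1 g35 `RootDecomp1KLogLogCell.lean`, sha256 05ce2a21…c847, own farm rc 0 · 0 sorry · axioms std; critic VERDICT STATUS L1698 PORT GO LOW;
port by census-1 gen 15 in eight parts `RootDecomp1KLogLogCell01`–`08` — see the PORT NOTE of part 01; `--supports stmt-Schanuel-33364`; rung 0.)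
-/

noncomputable section

open Complex IntermediateField Polynomial
open Summit.Schanuel.Schanuel.Theorems.RootDecomp1KHyper
open Summit.Schanuel.Schanuel.Theorems.RootDecomp1KHyper.HyperCell
open Summit.Schanuel.Schanuel.Theorems.RootDecomp1KGeneric
open Summit.Schanuel.Schanuel.Theorems.RootDecomp1KRelLiouvilleCell

namespace Summit.Schanuel.Schanuel.Theorems.RootDecomp1KLogLogCell

/-! ## §6  The member coordinate `ρ_E := Σ_J 2^{-(2J)!}` — log-log-Liouville, NOT log-square-Liouville

`ρ_E` is the EVEN-INDEX sub-series of `ℓ₂ = Σ_k 2^{-k!}`.  Its convergents `M/2^{(2J)!}` approximate it to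
`2·2^{-(2J+2)!} = q^{-(2J+1)(2J+2)+o(1)}` with `(2J+1)(2J+2) ≍ (log q / loglog q)²`‐free form
`exp(−c · log q · (2J)) ⊃ exp(−m · log q · loglog q)` (since `2J ≫ loglog q ≍ J log J`… precisely `(2J+2)!/(2J)! ≥
(2J)²` and `loglog q ≤ 2J·log(2J)`), so `ρ_E` IS log-log-Liouville; but the NEXT convergent only gains a factor
`(2J+3)(2J+4) ≤ 180·(2J)! ≤ 270 log q` in the exponent, so `|ρ_E − p/q| ≥ exp(−271 (log q)²)` for all `q ≥ 4`:
`ρ_E` is NOT log-square-Liouville (hence not log-hyper, not hyper-Liouville) — it lies OUTSIDE g34's cell. -/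

section Member
open LiouvilleNumber
open scoped Nat

/-- `(2(k+1))! = (2k)! · (2k+1)(2k+2)`. -/
theorem efact_succ (k : ℕ) : (2 * (k + 1))! = (2 * k)! * ((2 * k + 1) * (2 * k + 2)) := by
  rw [show 2 * (k + 1) = (2 * k + 1) + 1 by ring, Nat.factorial_succ, Nat.factorial_succ]; ring

/-- `(2k)! < (2(k+1))!`. -/
theorem efact_lt_succ (k : ℕ) : (2 * k)! < (2 * (k + 1))! := by
  rw [efact_succ]
  have h1 : 1 ≤ (2 * k)! := Nat.factorial_pos _
  have h2 : 2 ≤ (2 * k + 1) * (2 * k + 2) := by nlinarith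
  nlinarith

/-- `(2K)! + k ≤ (2(K+k))!`. -/
theorem efact_add_le (K k : ℕ) : (2 * K)! + k ≤ (2 * (K + k))! := by
  induction k with
  | zero => simp
  | succ k ih =>
    have := efact_lt_succ (K + k)
    rw [show K + (k + 1) = K + k + 1 by ring]
    omega

/-- `ρ_E := Σ_J 2^{-(2J)!}` — the even-index sub-series of `ℓ₂`'s digit skeleton. -/
def rhoE : ℝ := ∑' J, 1 / (2 : ℝ) ^ (2 * J)!

/-- The series `Σ_J 2^{-(2J)!}` is summable. -/
theorem summable_rhoE : Summable fun J => 1 / (2 : ℝ) ^ (2 * J)! :=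
  summable_one_div_pow_of_le (by norm_num) fun J =>
    (Nat.self_le_factorial (2 * J)).trans' (by omega)

/-- Partial sums: `Σ_{k ≤ K} 2^{-(2k)!} = M / 2^{(2K)!}` with `M` odd. -/
theorem rhoE_partialSum (K : ℕ) :
    ∃ M : ℕ, Odd M ∧ ∑ k ∈ Finset.range (K + 1), 1 / (2 : ℝ) ^ (2 * k)! = M / (2 : ℝ) ^ (2 * K)! := by
  induction K with
  | zero => exact ⟨1, odd_one, by simp⟩
  | succ K ih =>
    obtain ⟨M, hM, hs⟩ := ih
    have hlt := efact_lt_succ K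
    refine ⟨M * 2 ^ ((2 * (K + 1))! - (2 * K)!) + 1, ?_, ?_⟩
    · refine Even.add_one (Even.mul_left ?_ _)
      exact (Nat.even_pow' (by omega)).mpr (by decide)
    · rw [Finset.sum_range_succ, hs]
      have h2 : (2 : ℝ) ^ (2 * (K + 1))! = 2 ^ (2 * K)! * 2 ^ ((2 * (K + 1))! - (2 * K)!) := by
        rw [← pow_add, Nat.add_sub_cancel' hlt.le]
      rw [div_add_div _ _ (by positivity) (by positivity), div_eq_div_iff (by positivity)
        (by positivity)]
      push_cast
      rw [h2]
      ring

/-- The tails of `Σ_J 2^{-(2J)!}` are summable. -/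
theorem rhoE_tail_summable (K : ℕ) : Summable fun k : ℕ => 1 / (2 : ℝ) ^ (2 * (k + K))! :=
  (summable_nat_add_iff (f := fun J : ℕ => 1 / (2 : ℝ) ^ (2 * J)!) K).mpr summable_rhoE

/-- The tails of `Σ_J 2^{-(2J)!}` are positive. -/
theorem rhoE_tail_pos (K : ℕ) : 0 < ∑' k, 1 / (2 : ℝ) ^ (2 * (k + K))! :=
  (rhoE_tail_summable K).tsum_pos (fun _ => by positivity) 0 (by positivity)

/-- The first tail term bounds the tail from below. -/
theorem rhoE_first_le_tail (K : ℕ) : 1 / (2 : ℝ) ^ (2 * K)! ≤ ∑' k, 1 / (2 : ℝ) ^ (2 * (k + K))! := by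
  have h := (rhoE_tail_summable K).le_tsum 0 (fun j _ => by positivity)
  simpa using h

/-- Tail bound: `Σ_k 2^{-(2(k+K))!} ≤ 2 · 2^{-(2K)!}`. -/
theorem rhoE_tail_le (K : ℕ) :
    ∑' k, 1 / (2 : ℝ) ^ (2 * (k + K))! ≤ 2 * (1 / (2 : ℝ) ^ (2 * K)!) := by
  have hg : Summable fun k : ℕ => ((1 : ℝ) / 2) ^ k * (1 / (2 : ℝ) ^ (2 * K)!) :=
    summable_geometric_two.mul_right _
  have hf := rhoE_tail_summable K
  calc ∑' k, 1 / (2 : ℝ) ^ (2 * (k + K))!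
      ≤ ∑' k : ℕ, ((1 : ℝ) / 2) ^ k * (1 / (2 : ℝ) ^ (2 * K)!) := by
        refine Summable.tsum_le_tsum (fun k => ?_) hf hg
        have hle : k + (2 * K)! ≤ (2 * (k + K))! := by
          rw [Nat.add_comm k K, Nat.add_comm k]; exact efact_add_le K k
        rw [one_div_pow, one_div_mul_one_div, ← pow_add]
        exact one_div_pow_le_one_div_pow_of_le (by norm_num) hle
    _ = 2 * (1 / (2 : ℝ) ^ (2 * K)!) := by rw [tsum_mul_right, tsum_geometric_two]

/-- `ρ_E` is its `K`-th partial sum plus its tail. -/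
theorem rhoE_eq_partialSum_add_tail (K : ℕ) :
    rhoE = ∑ k ∈ Finset.range K, 1 / (2 : ℝ) ^ (2 * k)! + ∑' k, 1 / (2 : ℝ) ^ (2 * (k + K))! :=
  (summable_rhoE.sum_add_tsum_nat_add K).symm

/-- `ρ_E > 0`. -/
theorem rhoE_pos : 0 < rhoE := by
  have := rhoE_tail_pos 0; simpa [rhoE] using this

/-- `ρ_E < 1`. -/
theorem rhoE_lt_one : rhoE < 1 := by
  have h := rhoE_tail_le 2
  rw [rhoE_eq_partialSum_add_tail 2]
  set Tt : ℝ := ∑' k, 1 / (2 : ℝ) ^ (2 * (k + 2))! with hTt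
  have e4 : (2 * 2)! = 24 := by decide
  rw [e4] at h
  norm_num [Finset.sum_range_succ, Nat.factorial_two, Nat.factorial_zero] at h ⊢
  linarith

/-- `1/4 < e^{-1}` (verbatim copy of g34). -/
private theorem one_div_four_lt_exp_neg_one : (1 : ℝ) / 4 < Real.exp (-1) := by
  rw [Real.exp_neg, ← one_div]
  exact one_div_lt_one_div_of_lt (Real.exp_pos 1) (by have := Real.exp_one_lt_d9; linarith)

/-- `2m(2m+4) ≤ 2^{2m+4}`. -/
private theorem two_mul_mul_le_two_pow (m : ℕ) : 2 * m * (2 * m + 4) ≤ 2 ^ (2 * m + 4) := by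
  have h1 : m ≤ 2 ^ m := Nat.lt_two_pow_self.le
  have h2 : 2 ^ (2 * m + 4) = 16 * (2 ^ m * 2 ^ m) := by
    rw [pow_add, two_mul, pow_add]; norm_num; ring
  rw [h2]
  have h3 : 1 ≤ 2 ^ m := Nat.one_le_two_pow
  nlinarith [h1, h3]

/-- The budget inequality of the member: `2(m·t!·t·s + 1) + 1 ≤ (t+2)!` once `2ms ≤ t` and `t ≥ 4`. -/
private theorem budget_ineq {m t s : ℕ} (h2ms : 2 * m * s ≤ t) (ht : 4 ≤ t) :
    2 * (m * t ! * t * s + 1) + 1 ≤ (t + 2)! := by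
  have h1 : (t + 2)! = (t + 2) * ((t + 1) * t !) := by
    rw [show t + 2 = (t + 1) + 1 by ring, Nat.factorial_succ, Nat.factorial_succ]
  rw [h1]
  have h2 : 1 ≤ t ! := Nat.factorial_pos t
  have h3 : 2 * m * s * (t ! * t) ≤ t * (t ! * t) := Nat.mul_le_mul_right _ h2ms
  have h4 : 4 ≤ t * t ! := by nlinarith
  nlinarith [h3, h4, h2]

/-- **`ρ_E` is log-log-Liouville** (hypothesis-free): the convergent `M/2^{(2J)!}`, `2J = 2^{2m+4}`, wins
`|ρ_E − r| < exp(−m · log q · loglog q)`, `q = r.den = 2^{(2J)!} ≥ m`. -/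
theorem logLogLiouville_rhoE : LogLogLiouville rhoE := by
  intro m
  set s : ℕ := 2 * m + 4 with hs
  set J : ℕ := 2 ^ (2 * m + 3) with hJ
  set t : ℕ := 2 * J with ht
  have hts : t = 2 ^ s := by
    rw [ht, hJ, hs, show 2 * m + 4 = (2 * m + 3) + 1 by ring, pow_succ]; ring
  have hs4 : 4 ≤ s := by omega
  have hst : s ≤ t := by rw [hts]; exact Nat.lt_two_pow_self.le
  have ht4 : 4 ≤ t := hs4.trans hst
  have h2ms : 2 * m * s ≤ t := by rw [hts, hs]; exact two_mul_mul_le_two_pow m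
  obtain ⟨M, hModd, hsum⟩ := rhoE_partialSum J
  set a : ℕ := (2 * J)! with ha
  have hat : a = t ! := by rw [ha, ht]
  have hta : t ≤ a := by rw [hat]; exact Nat.self_le_factorial t
  have ha4 : 4 ≤ a := ht4.trans hta
  set r : ℚ := (M : ℚ) / ((2 : ℚ) ^ a) with hr
  have hden : r.den = 2 ^ a := by
    have hcop : Nat.Coprime (M : ℤ).natAbs ((2 : ℤ) ^ a).natAbs := by
      rw [Int.natAbs_natCast, Int.natAbs_pow]
      exact Nat.Coprime.pow_right a (Nat.coprime_two_right.mpr hModd)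
    have h := Rat.den_div_eq_of_coprime (a := (M : ℤ)) (b := (2 : ℤ) ^ a) (by positivity) hcop
    have e : ((M : ℤ) : ℚ) / (((2 : ℤ) ^ a : ℤ) : ℚ) = r := by rw [hr]; push_cast; rfl
    rw [e] at h
    exact_mod_cast h
  have hrR : (r : ℝ) = ∑ k ∈ Finset.range (J + 1), 1 / (2 : ℝ) ^ (2 * k)! := by
    rw [hsum, hr]; push_cast; rfl
  set T : ℝ := ∑' k, 1 / (2 : ℝ) ^ (2 * (k + (J + 1)))! with hT
  have hlam : rhoE - r = T := by rw [hrR, rhoE_eq_partialSum_add_tail (J + 1)]; ring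
  have hTpos : 0 < T := rhoE_tail_pos (J + 1)
  have hTle : T ≤ 2 * (1 / (2 : ℝ) ^ (2 * (J + 1))!) := rhoE_tail_le (J + 1)
  refine ⟨r, ?_, ?_, ?_⟩
  · rw [hden]
    calc m ≤ s := by omega
      _ ≤ t := hst
      _ ≤ a := hta
      _ ≤ 2 ^ a := Nat.lt_two_pow_self.le
  · intro h
    have : rhoE - r = 0 := by rw [h, sub_self]
    rw [hlam] at this
    exact hTpos.ne' this
  · rw [hlam, abs_of_pos hTpos, hden]
    set E : ℕ := m * a * t * s + 1 with hE
    have hE0 : E ≠ 0 := by omega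
    have hN : 2 * E + 1 ≤ (2 * (J + 1))! := by
      have e1 : 2 * (J + 1) = t + 2 := by omega
      rw [e1, hE, hat]
      exact budget_ineq h2ms ht4
    have hq : ((2 ^ a : ℕ) : ℝ) = (2 : ℝ) ^ a := by push_cast; rfl
    set L : ℝ := Real.log ((2 ^ a : ℕ) : ℝ) with hL
    have hLa : L = a * Real.log 2 := by rw [hL, hq, Real.log_pow]
    have hlog2 := Real.log_two_gt_d9
    have hlog2' := Real.log_two_lt_d9
    have haR : (4 : ℝ) ≤ a := by exact_mod_cast ha4
    have ha0 : (0 : ℝ) < a := by linarith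
    have hL1 : 1 ≤ L := by rw [hLa]; nlinarith
    have hL0 : 0 < L := by linarith
    have hLle : L ≤ a := by rw [hLa]; nlinarith
    have hlogL0 : 0 ≤ Real.log L := Real.log_nonneg hL1
    have htR : (t : ℝ) = 2 ^ s := by rw [hts]; push_cast; rfl
    have ht0 : (0 : ℝ) < t := by rw [htR]; positivity
    have hsR : (0 : ℝ) ≤ s := Nat.cast_nonneg s
    have hlogt : Real.log t ≤ s := by
      rw [htR, Real.log_pow]
      nlinarith
    have hloga : Real.log a ≤ t * s := by
      have h1 : (a : ℝ) ≤ (t : ℝ) ^ t := by rw [hat]; exact_mod_cast Nat.factorial_le_pow t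
      have h2 : Real.log a ≤ Real.log ((t : ℝ) ^ t) := Real.log_le_log ha0 h1
      rw [Real.log_pow] at h2
      have h3 : (t : ℝ) * Real.log t ≤ t * s := mul_le_mul_of_nonneg_left hlogt ht0.le
      linarith
    have hlogL : Real.log L ≤ t * s := (Real.log_le_log hL0 hLle).trans hloga
    have hmE : (m : ℝ) * L * Real.log L ≤ E := by
      have h1 : (m : ℝ) * L * Real.log L ≤ m * a * (t * s) :=
        mul_le_mul (mul_le_mul_of_nonneg_left hLle (Nat.cast_nonneg m)) hlogL hlogL0 (by positivity)
      rw [hE]; push_cast; linarith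
    calc T ≤ 2 * (1 / (2 : ℝ) ^ (2 * (J + 1))!) := hTle
      _ ≤ 2 * (1 / (2 : ℝ) ^ (2 * E + 1)) :=
          mul_le_mul_of_nonneg_left (one_div_pow_le_one_div_pow_of_le (by norm_num) hN) (by norm_num)
      _ = ((1 : ℝ) / 4) ^ E := by
          rw [one_div_pow, pow_succ, pow_mul]; norm_num; ring
      _ < (Real.exp (-1)) ^ E := pow_lt_pow_left₀ one_div_four_lt_exp_neg_one (by norm_num) hE0
      _ = Real.exp (-(E : ℝ)) := by rw [← Real.exp_nat_mul]; ring_nf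
      _ ≤ Real.exp (-((m : ℝ) * L * Real.log L)) := Real.exp_le_exp.mpr (neg_le_neg hmE)

/-- `(2k+1)(2k+2)(2k+3)(2k+4) ≤ 180 · (2k)!` for `k ≥ 1` (equality at `k = 1`). -/
private theorem prod_four_le_factorial {k : ℕ} (hk : 1 ≤ k) :
    (2 * k + 1) * (2 * k + 2) * (2 * k + 3) * (2 * k + 4) ≤ 180 * (2 * k)! := by
  induction k, hk using Nat.le_induction with
  | base => decide
  | succ n hn ih =>
    have e1 : (2 * (n + 1))! = (2 * n)! * ((2 * n + 1) * (2 * n + 2)) := efact_succ n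
    have e2 : 2 * (n + 1) = 2 * n + 2 := by ring
    rw [e2] at e1 ⊢
    have hu : 12 ≤ (2 * n + 1) * (2 * n + 2) := by nlinarith
    have h0 : (2 * n + 5) * (2 * n + 6) ≤ 12 * ((2 * n + 1) * (2 * n + 2)) := by nlinarith
    have h1 : (2 * n + 5) * (2 * n + 6) ≤ (2 * n + 1) * (2 * n + 2) * ((2 * n + 1) * (2 * n + 2)) :=
      h0.trans (Nat.mul_le_mul_right _ hu)
    calc (2 * n + 2 + 1) * (2 * n + 2 + 2) * (2 * n + 2 + 3) * (2 * n + 2 + 4)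
        = (2 * n + 3) * (2 * n + 4) * ((2 * n + 5) * (2 * n + 6)) := by ring
      _ ≤ (2 * n + 3) * (2 * n + 4) * ((2 * n + 1) * (2 * n + 2) * ((2 * n + 1) * (2 * n + 2))) :=
          Nat.mul_le_mul_left _ h1
      _ = ((2 * n + 1) * (2 * n + 2) * (2 * n + 3) * (2 * n + 4)) * ((2 * n + 1) * (2 * n + 2)) := by
          ring
      _ ≤ (180 * (2 * n)!) * ((2 * n + 1) * (2 * n + 2)) := Nat.mul_le_mul_right _ ih
      _ = 180 * (2 * n + 2)! := by rw [e1]; ring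

end Member

end Summit.Schanuel.Schanuel.Theorems.RootDecomp1KLogLogCell
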